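import Mathlib
import Summits.Ventures.PercRepro2.Defs
import Summits.Ventures.PercRepro2.Harris
import Summits.Ventures.PercRepro2.Graph
import Summits.Ventures.PercRepro2.Events
import Summits.Ventures.PercRepro2.Induced
import Summits.Ventures.PercRepro2.SameClusterAvoid
import Summits.Ventures.PercRepro2.BHKAvoid
import Summits.Ventures.PercRepro2.CCTRootEdge
import Summits.Ventures.PercRepro2.CCTAvoidedEdge
import Summits.Ventures.PercRepro2.OneRootDropMono
import Summits.Ventures.PercRepro2.TwoRootLeanMono

/-!
# The free-vertex odds `P(v ∈ C₁) · P(v ∉ C₁) / P(v ∉ C₁ ∪ C₂)` grow with every edge at `v`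
(blind cell PercRepro2, mine-c g29; `conjectures/MINE-C.md` §38.4)

Roots `a₁, a₂`, a vertex `v`, the two-root conditioning `Q = {a₁ ↮ a₂}`, and an edge `e = {v, y}` at
`v` of weight `t` (`y` any vertex, `y ≠ v`).  With `E = Q ∩ {v ∈ C₁}`, `N = Q ∩ {v ∉ C₁}`,
`A = Q ∩ {v ∉ C₁ ∪ C₂}` the quantity

  `pref p = P_p(E) · P_p(N) / (P_p(Q) · P_p(A))   (= ν(v ∈ C₁) ν(v ∉ C₁) / ν(v ∉ U),  ν = P(· | Q))`

is non-decreasing in `t` on `[0, 1]` wherever `P_t(A) > 0`.  This is the `X = 1[v ∈ C₁]` case of the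
lens's (Φ-COR) and the prefactor of the contrast form `Λ₊ = pref · (E[σ_b | v ∈ C₁] − E[σ_b | v ∉ C₁])`.

Proof.  Write the nine STATUS CLASSES of the `e`-closed instance — `(s_v, s_y)` with `s_z ∈ {1, 2, 0}`
for `z ∈ C₁ / z ∈ C₂ / z ∉ C₁ ∪ C₂` — as `c_ij = P₀(class ij)`; the `e`-open (glued) masses are unions
of classes (`Q₁ = Q − c₁₂ − c₂₁`, `E₁ = c₀₁ + c₁₀ + c₁₁`, `N₁ = c₀₀ + c₀₂ + c₂₀ + c₂₂`, `A₁ = c₀₀`), and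
every mass at weight `w` is `w · (glued) + (1 − w) · (closed)` (`prob_update_eq_pin`).  Two BHK06
Theorem 1.4 inequalities with an avoided set (`bhk_cross_cluster_avoid`) — in the world `a₁ ↮ {a₂, v}`
the events `{y ∈ C₁}`, `{v ∈ C₂}` are negatively correlated, and in the world `a₂ ↮ {a₁, v}` so are
`{y ∈ C₂}`, `{v ∈ C₁}` — read, in class masses,

  `ba := (c₂₀ + c₂₁ + c₂₂) c₀₁ − (c₀₀ + c₀₁ + c₀₂) c₂₁ ≥ 0`,  `bb := (c₁₀ + c₁₁ + c₁₂) c₀₂ − (c₀₀ + c₀₁ + c₀₂) c₁₂ ≥ 0`.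

The difference `F(t, s) = E_t N_t Q_s A_s − E_s N_s Q_t A_t` then satisfies the exact polynomial identities
`F · (1 − s)² = (1 − t)(t − s) L + (t − s)² End_s`, `Q₁ L = Q_s End_s + A_s (E₁ Q_s − E_s Q₁)²`,
`End_s = (1 − s)² End₀ + s (1 − s) M`, and `End₀`, `M` are explicit non-negative combinations of
`ba`, `bb` and products of class masses (`end0_cert`, `m_cert`), which gives `F ≥ 0`.
-/

namespace Summit.Ventures.PercRepro2

namespace PrefMono

variable {V : Type*} {E : Type*} [Fintype V] [DecidableEq V] [Fintype E] [DecidableEq E]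
  {R : Type*} [Field R] [LinearOrder R] [IsStrictOrderedRing R]

/-- The two-root conditioning `Q = {a₁ ↮ a₂}`. -/
def QEvent (ends : E → Sym2 V) (a₁ a₂ : V) : Set (Config E) := avoidAll ends a₁ {a₂}

/-- `E = Q ∩ {v ∈ C₁}`. -/
def EEvent (ends : E → Sym2 V) (a₁ a₂ v : V) : Set (Config E) :=
  QEvent ends a₁ a₂ ∩ connEvent ends a₁ v

/-- `A = Q ∩ {v ∉ C₁ ∪ C₂} = {a₁ ↮ a₂, a₁ ↮ v} ∩ {a₂ ↮ v}`. -/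
def AEvent (ends : E → Sym2 V) (a₁ a₂ v : V) : Set (Config E) :=
  TwoRootLean.NEvent ends a₁ a₂ v ∩ avoidAll ends a₂ {v}

/-- The free-vertex odds `P(E) · P(N) / (P(Q) · P(A))` (`= ν(v ∈ C₁) ν(v ∉ C₁) / ν(v ∉ U)`). -/
noncomputable def pref (p : E → R) (ends : E → Sym2 V) (a₁ a₂ v : V) : R :=
  prob p (EEvent ends a₁ a₂ v) * prob p (TwoRootLean.NEvent ends a₁ a₂ v) /
    (prob p (QEvent ends a₁ a₂) * prob p (AEvent ends a₁ a₂ v))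


section Sets

variable {ends : E → Sym2 V} {a₁ a₂ : V}

omit [Fintype V] [DecidableEq V] [Fintype E] [DecidableEq E] in
/-- Under `Q`, a vertex connected to `a₁` is not connected to `a₂`. -/
lemma not_conn₂_of_conn₁ {ω : Config E} (hQ : ω ∈ QEvent ends a₁ a₂) {x : V}
    (h : Conn ends ω a₁ x) : ¬ Conn ends ω a₂ x := fun h2 =>
  hQ a₂ (Finset.mem_singleton_self _) (conn_trans h (conn_symm h2))

omit [Fintype V] [DecidableEq V] [Fintype E] [DecidableEq E] in
/-- Under `Q`, a vertex connected to `a₂` is not connected to `a₁`. -/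
lemma not_conn₁_of_conn₂ {ω : Config E} (hQ : ω ∈ QEvent ends a₁ a₂) {x : V}
    (h : Conn ends ω a₂ x) : ¬ Conn ends ω a₁ x := fun h1 => not_conn₂_of_conn₁ hQ h1 h

omit [Fintype V] [Fintype E] [DecidableEq E] in
/-- Membership in `N = {a₁ ↮ a₂, a₁ ↮ v}`: `Q` and `v ∉ C₁`. -/
lemma mem_N_iff {ω : Config E} {v : V} :
    ω ∈ TwoRootLean.NEvent ends a₁ a₂ v ↔ ω ∈ QEvent ends a₁ a₂ ∧ ¬ Conn ends ω a₁ v := by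
  simp only [TwoRootLean.NEvent, QEvent, avoidAll, Set.mem_setOf_eq, Finset.mem_insert,
    Finset.mem_singleton, forall_eq_or_imp, forall_eq]

omit [Fintype V] [Fintype E] [DecidableEq E] in
/-- Membership in `A`: `Q`, `v ∉ C₁` and `v ∉ C₂`. -/
lemma mem_A_iff {ω : Config E} {v : V} :
    ω ∈ AEvent ends a₁ a₂ v ↔
      ω ∈ QEvent ends a₁ a₂ ∧ ¬ Conn ends ω a₁ v ∧ ¬ Conn ends ω a₂ v := by
  simp only [AEvent, Set.mem_inter_iff, mem_N_iff, avoidAll, Set.mem_setOf_eq,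
    Finset.mem_singleton, forall_eq, and_assoc]

omit [Fintype V] [DecidableEq V] [Fintype E] [DecidableEq E] in
/-- Membership in `E`: `Q` and `v ∈ C₁`. -/
lemma mem_E_iff {ω : Config E} {v : V} :
    ω ∈ EEvent ends a₁ a₂ v ↔ ω ∈ QEvent ends a₁ a₂ ∧ Conn ends ω a₁ v := by
  simp only [EEvent, Set.mem_inter_iff, mem_connEvent]

omit [Fintype V] [DecidableEq V] [Fintype E] [DecidableEq E] in
/-- Avoiding a singleton is not being connected to it. -/
lemma mem_avoid_single_iff {ω : Config E} {x z : V} :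
    ω ∈ avoidAll ends x {z} ↔ ¬ Conn ends ω x z := by
  simp only [avoidAll, Set.mem_setOf_eq, Finset.mem_singleton, forall_eq]

end Sets

section Glue

variable {ends : E → Sym2 V} {e : E} {v y : V}

/-- Opening `e = {v, y}`: the cluster of any vertex `x` after the opening, in terms of the closed
configuration — either `x` touches neither end and nothing changes, or it touches one end and
then reaches exactly what `v` or `y` reached. -/
lemma conn_update_true_iff (hends : ends e = s(v, y)) (ω : Config E) (x z : V) :
    Conn ends (Function.update ω e true) x z ↔
      Conn ends (Function.update ω e false) x z ∨
        ((Conn ends (Function.update ω e false) x v ∨ Conn ends (Function.update ω e false) x y) ∧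
          (Conn ends (Function.update ω e false) v z ∨
            Conn ends (Function.update ω e false) y z)) := by
  have hle := CCT.update_false_le_update_true' ω e
  have hvy : Conn ends (Function.update ω e true) v y := conn_of_openAdj ⟨e, by simp, hends⟩
  have hcl := CCT.cluster_update_true_eq hends ω
  have keyv : ∀ z, Conn ends (Function.update ω e true) v z ↔
      Conn ends (Function.update ω e false) v z ∨ Conn ends (Function.update ω e false) y z := by
    intro z
    rw [← mem_cluster, hcl, Set.mem_union, mem_cluster, mem_cluster]
  constructor
  · intro h
    by_cases htouch : Conn ends (Function.update ω e false) x v ∨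
        Conn ends (Function.update ω e false) x y
    · refine Or.inr ⟨htouch, ?_⟩
      rcases htouch with hxv | hxy
      · exact (keyv z).1 (conn_trans (conn_symm (conn_mono hle hxv)) h)
      · exact (keyv z).1 (conn_trans (conn_symm (conn_trans (conn_mono hle hxy)
          (conn_symm hvy))) h)
    · have htouch' := not_or.mp htouch
      have hcx : cluster ends (Function.update ω e true) x =
          cluster ends (Function.update ω e false) x :=
        CCT.cluster_update_true_eq_of_not_touch ends hends ω x
          (by rw [mem_cluster]; exact htouch'.1) (by rw [mem_cluster]; exact htouch'.2)
      left
      rw [← mem_cluster, ← hcx, mem_cluster]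
      exact h
  · rintro (h | ⟨hx, hz⟩)
    · exact conn_mono hle h
    · have hvz : Conn ends (Function.update ω e true) v z := (keyv z).2 hz
      rcases hx with hxv | hxy
      · exact conn_trans (conn_mono hle hxv) hvz
      · exact conn_trans (conn_trans (conn_mono hle hxy) (conn_symm hvy)) hvz

variable (a₁ a₂ : V)

/-- Opening `e = {v, y}`: `Q` holds afterwards iff it held before and `v, y` were not on opposite
sides. -/
lemma update_true_mem_Q_iff (hends : ends e = s(v, y)) (ω : Config E) :
    Function.update ω e true ∈ QEvent ends a₁ a₂ ↔
      Function.update ω e false ∈ QEvent ends a₁ a₂ ∧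
        ¬ (Conn ends (Function.update ω e false) a₁ v ∧
            Conn ends (Function.update ω e false) a₂ y) ∧
        ¬ (Conn ends (Function.update ω e false) a₂ v ∧
            Conn ends (Function.update ω e false) a₁ y) := by
  simp only [QEvent, avoidAll, Set.mem_setOf_eq, Finset.mem_singleton, forall_eq]
  rw [conn_update_true_iff hends ω a₁ a₂]
  set ω₀ := Function.update ω e false
  constructor
  · intro h
    have h' := not_or.mp h
    refine ⟨h'.1, ?_, ?_⟩
    · rintro ⟨h1v, h2y⟩
      exact h'.2 ⟨Or.inl h1v, Or.inr (conn_symm h2y)⟩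
    · rintro ⟨h2v, h1y⟩
      exact h'.2 ⟨Or.inr h1y, Or.inl (conn_symm h2v)⟩
  · rintro ⟨hQ, h12, h21⟩
    rintro (h | ⟨hx, hz⟩)
    · exact hQ h
    · rcases hx with hxv | hxy <;> rcases hz with hzv | hzy
      · exact hQ (conn_trans hxv hzv)
      · exact h12 ⟨hxv, conn_symm hzy⟩
      · exact h21 ⟨conn_symm hzv, hxy⟩
      · exact hQ (conn_trans hxy hzy)

/-- Opening `e = {v, y}`: `E = Q ∩ {v ∈ C₁}` holds afterwards iff, before, `Q` held, `v, y` were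
not on opposite sides, and `v` or `y` was in `C₁`. -/
lemma update_true_mem_E_iff (hends : ends e = s(v, y)) (ω : Config E) :
    Function.update ω e true ∈ EEvent ends a₁ a₂ v ↔
      Function.update ω e false ∈ QEvent ends a₁ a₂ ∧
        ¬ (Conn ends (Function.update ω e false) a₁ v ∧
            Conn ends (Function.update ω e false) a₂ y) ∧
        ¬ (Conn ends (Function.update ω e false) a₂ v ∧
            Conn ends (Function.update ω e false) a₁ y) ∧
        (Conn ends (Function.update ω e false) a₁ v ∨
          Conn ends (Function.update ω e false) a₁ y) := by
  rw [mem_E_iff, update_true_mem_Q_iff a₁ a₂ hends ω, conn_update_true_iff hends ω a₁ v]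
  set ω₀ := Function.update ω e false
  constructor
  · rintro ⟨⟨hQ, h12, h21⟩, h⟩
    refine ⟨hQ, h12, h21, ?_⟩
    rcases h with h | ⟨hx, _⟩
    · exact Or.inl h
    · exact hx
  · rintro ⟨hQ, h12, h21, h⟩
    refine ⟨⟨hQ, h12, h21⟩, ?_⟩
    rcases h with h | h
    · exact Or.inl h
    · exact Or.inr ⟨Or.inr h, Or.inl (conn_refl _ _ _)⟩

/-- Opening `e = {v, y}`: `A = Q ∩ {v ∉ C₁ ∪ C₂}` holds afterwards iff, before, `A` held and also
`y ∉ C₁ ∪ C₂`. -/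
lemma update_true_mem_A_iff (hends : ends e = s(v, y)) (ω : Config E) :
    Function.update ω e true ∈ AEvent ends a₁ a₂ v ↔
      Function.update ω e false ∈ AEvent ends a₁ a₂ v ∧
        ¬ Conn ends (Function.update ω e false) a₁ y ∧
        ¬ Conn ends (Function.update ω e false) a₂ y := by
  simp only [mem_A_iff]
  rw [conn_update_true_iff hends ω a₁ v, conn_update_true_iff hends ω a₂ v,
    update_true_mem_Q_iff a₁ a₂ hends ω]
  set ω₀ := Function.update ω e false
  have hr : Conn ends ω₀ v v := conn_refl _ _ _
  constructor
  · rintro ⟨⟨hQ, _, _⟩, h1, h2⟩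
    have h1' := not_or.mp h1
    have h2' := not_or.mp h2
    refine ⟨⟨hQ, h1'.1, h2'.1⟩, ?_, ?_⟩
    · intro h1y; exact h1'.2 ⟨Or.inr h1y, Or.inl hr⟩
    · intro h2y; exact h2'.2 ⟨Or.inr h2y, Or.inl hr⟩
  · rintro ⟨⟨hQ, h1v, h2v⟩, h1y, h2y⟩
    refine ⟨⟨hQ, fun h => h1v h.1, fun h => h2v h.1⟩, ?_, ?_⟩
    · rintro (h | ⟨hx, _⟩)
      · exact h1v h
      · rcases hx with hx | hx
        · exact h1v hx
        · exact h1y hx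
    · rintro (h | ⟨hx, _⟩)
      · exact h2v h
      · rcases hx with hx | hx
        · exact h2v hx
        · exact h2y hx

end Glue

end PrefMono

end Summit.Ventures.PercRepro2
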